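import Literature.MathematicalPhysics.QuantumLattice.TwistedAdjointLaplacianGap
import Literature.MathematicalPhysics.QuantumFieldTheory.WilsonFinTorusTwistedPartition
import HarnessLib

/-!
# The ladder ↔ twisted-periodic dictionary for adjoint fields, and the covariant Laplacian gap `4 sin²(π/(Nℓ))`
# at a twist-eating LADDER background on the `Fin` box (uniform in the untwisted extents)

Topic `Literature/MathematicalPhysics/QuantumLattice`; sequel of `TwistedAdjointLaplacianGap.lean` (★ `twistedTorus_poincare_sharp`,
the TWISTED-PERIODIC picture: fields `Φ : ℕ² → M_N(ℂ)` with `Φ(x+ℓ,y) = AΦAᴴ`, `Φ(x,y+ℓ) = BΦBᴴ` around the background `U ≡ 1`)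
written for the other standard gauge of the same twist sector — the LADDER (transition-function) picture on a genuinely periodic
`Fin` box: the background link field is `A` on the sheet `x₀ = 0` of `0`-links, `B` on the sheet `x₁ = 0` of `1`-links, and
central (or `1`) on the remaining links, so that every plaquette is central and the twist `ω̄ = (ABA⁻¹B⁻¹)⁻¹` is eaten
('t Hooft's twist-eating transition functions, 't Hooft 1979 §3, written as a lattice gauge field; González-Arroyo 1998 §3, §8.1;
the `ladderConfig` of the tree's `Summit…TwistedSlabGauge`, here kept hypothesis-parametrised: `U₀ 0 _ = A`, `U₀ x₀ _ = 1`
for `x₀ ≠ 0`, etc.).  The two pictures differ by the discrete gauge transformation ∕ change of variables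

  `Φ̃(y₀, y₁) = Ω(y) · Φ((y₀ + 1) mod ℓ, (y₁ + 1) mod ℓ) · Ω(y)ᴴ`,  `Ω(y) = A^{⌊y₀/ℓ⌋} B^{⌊y₁/ℓ⌋}`  (`ladderLift`, `ladderTransition`)

(the accumulated transition function along the path from the fundamental domain; the unit offset puts the `A`-sheet of the
ladder on the seam of the fundamental domain `{1,…,ℓ}²`).  THE DICTIONARY (§2): `Φ̃` is twisted-periodic
(`ladderLift_add_left ∕ _right`), traceless if `Φ` is (`trace_ladderLift`), its Hilbert–Schmidt energy at `y` is that of `Φ` at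
the corresponding site (`energy_ladderLift`), and — the point — its PLAIN forward differences are the unitary conjugates
`Ω(y)·(D_μΦ)(x)·Ω(y)ᴴ` of the COVARIANT differences of `Φ` in the ladder background,
`(D₀Φ)(x) = U₀(x) Φ(x+e₀) U₀(x)ᴴ − Φ(x)` (`ladderLift_succ_left_sub`, `ladderLift_succ_right_sub`; energies
`energy_ladderLift_succ_left_sub ∕ _right_sub`).  Since the map is «conjugate and relabel», it applies verbatim to each
component `a_ν` of a lattice 1-form: covariant curls ∕ divergences in the ladder picture become plain ones of the lift (this is
how the tree's `twistedTorus_oneForm_gap_of_div_eq_zero` ∕ `slabWindowWilsonAction_hessian_gap` are read at a ladder).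

THE APPLICATION (§3): ★ `ladder_poincare_sharp` — on the periodic `ℓ × ℓ` `Fin` torus with the ladder background, every traceless
adjoint field satisfies `4 sin²(π/(Nℓ)) · Σ_x S(Φ x) ≤ Σ_x [S(D₀Φ x) + S(D₁Φ x)]`, `S(X) = Re tr(XᴴX)`; ★★
`ladder_finTorus_poincare_sharp` — the same on the anisotropic four-dimensional `Fin` box `ℓ × ℓ × L₂ × L₃` of the tree's
`FinTorusSite ∕ FinTorusSite.shift ∕ finTorusSiteCoord` currency, with ALL FOUR covariant differences on the right and NO
hypothesis on the links in the untwisted directions `2, 3` (their terms are only dropped): the covariant Laplacian of the ladder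
background has the 0-form gap `4 sin²(π/(Nℓ))` on traceless fields, UNIFORMLY in `L₂, L₃` — the `hm` input of
`Literature.Analysis.OperatorTheory.DiscreteWeitzenboeck.gap_of_div_eq_zero` ∕ `det_hessianSlice_eq_det_covLaplacian_pow` for
the twist-eating ladder, in the box currency of the twisted slab line (anchor T1).

HONEST FRAMING: finite-dimensional lattice algebra (a change of variables and a Poincaré inequality); tree-level input only;
nothing here is uniform in `β`, nothing bears on vacuum dominance (T1), `IRcof`/`IR`, or the Yang–Mills mass gap (Clay), which
is NOT proved; `R4` closes only `BalabanLadder.UV`.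

References: G. 't Hooft, Nucl. Phys. B 153 (1979) 141, §3 (twist-eating transition functions `Ω_μ`, `Ω_μΩ_ν = Ω_νΩ_μ z_{μν}`);
A. González-Arroyo, *Yang–Mills fields on the four-dimensional torus. Part I*, hep-th/9807108, §3 «Boundary Conditions and Twist»
(corpus `paper:arxiv-hep-th_9807108` p0004 L1–L30: `A_μ(x + l_ν ν̂) = Ω_ν(x)[A_μ(x)]`, twist matrices, `Ω_ρΩ_ν = z_{ρν}Ω_νΩ_ρ`) and §8.1
(p0012 L55–L70: the gauge transformation `Ω⁺(x)` trading a vector potential for constant twist matrices — the two pictures of one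
twist sector); M. García Pérez, A. González-Arroyo, M. Okawa, IJMPA 29 (2014)
1445001, arXiv:1406.5655, §3 (corpus `paper:arxiv-1406.5655` p0006 L1–L22: adjoint fields in the twisted box, momenta
«quantized in units of `2π/(N l_μ)` … excluding zero»); JHEP 10 (2017) 150, arXiv:1708.00841, §2.2–§2.3 (corpus
`paper:arxiv-1708.00841` p0006 L19–L35: `∇_μ⁺A(n) = Γ_μ(n)A(n+μ̂)Γ_μ†(n) − A(n)`, the background entering only through
conjugation by the links).
-/

namespace Literature.MathematicalPhysics.QuantumLattice

open scoped Matrix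
open Finset Literature.MathematicalPhysics.QuantumFieldTheory

variable {N : ℕ}

/-! ## §1 The accumulated transition function and the lift -/

section Lift

variable (A B : Matrix (Fin N) (Fin N) ℂ) (ℓ : ℕ)

/-- The accumulated transition function `Ω(y₀,y₁) = A^{⌊y₀/ℓ⌋} B^{⌊y₁/ℓ⌋}` of the ladder background along the path from the
fundamental domain to the cell of `y`. [cite: tHooft1979Flux, §3] -/
def ladderTransition (y₀ y₁ : ℕ) : Matrix (Fin N) (Fin N) ℂ :=
  A ^ (y₀ / ℓ) * B ^ (y₁ / ℓ)

variable [NeZero ℓ]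

/-- The TWISTED-PERIODIC LIFT of an adjoint field `Φ` on the periodic `ℓ × ℓ` `Fin` torus carrying the ladder background:
`Φ̃(y₀,y₁) = Ω(y) Φ((y₀+1) mod ℓ, (y₁+1) mod ℓ) Ω(y)ᴴ`. [cite: Gonzalezarroyo1998, §3, §8.1] -/
def ladderLift (Φ : Fin ℓ → Fin ℓ → Matrix (Fin N) (Fin N) ℂ) (y₀ y₁ : ℕ) : Matrix (Fin N) (Fin N) ℂ :=
  ladderTransition A B ℓ y₀ y₁ * Φ (Fin.ofNat ℓ (y₀ + 1)) (Fin.ofNat ℓ (y₁ + 1)) * (ladderTransition A B ℓ y₀ y₁)ᴴ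

omit [NeZero ℓ] in
/-- Unfolding lemma. [cite: tHooft1979Flux, §3] -/
theorem ladderTransition_def (y₀ y₁ : ℕ) : ladderTransition A B ℓ y₀ y₁ = A ^ (y₀ / ℓ) * B ^ (y₁ / ℓ) := rfl

/-- Unfolding lemma. [cite: Gonzalezarroyo1998, §3, §8.1] -/
theorem ladderLift_def (Φ : Fin ℓ → Fin ℓ → Matrix (Fin N) (Fin N) ℂ) (y₀ y₁ : ℕ) :
    ladderLift A B ℓ Φ y₀ y₁ =
      ladderTransition A B ℓ y₀ y₁ * Φ (Fin.ofNat ℓ (y₀ + 1)) (Fin.ofNat ℓ (y₁ + 1)) *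
        (ladderTransition A B ℓ y₀ y₁)ᴴ := rfl

end Lift

/-! ## §2 The dictionary: twisted periodicity, trace, energies, covariant ↔ plain differences -/

section Dictionary

variable {A B : Matrix (Fin N) (Fin N) ℂ} {ω : ℂ} {ℓ : ℕ}

/-- Weyl relation for powers: `A^q B = ω^q · B A^q`. [cite: tHooft1979Flux, §3] -/
theorem pow_mul_eq_smul_of_weyl (hAB : A * B = ω • (B * A)) (q : ℕ) : A ^ q * B = ω ^ q • (B * A ^ q) := by
  induction q with
  | zero => simp
  | succ q ih =>
    rw [pow_succ', Matrix.mul_assoc, ih, Matrix.mul_smul, ← Matrix.mul_assoc, hAB, Matrix.smul_mul,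
      Matrix.mul_assoc, smul_smul, pow_succ', mul_comm ω (ω ^ q)]

/-- Weyl relation for powers: `A B^q = ω^q · B^q A`. [cite: tHooft1979Flux, §3] -/
theorem mul_pow_eq_smul_of_weyl (hAB : A * B = ω • (B * A)) (q : ℕ) : A * B ^ q = ω ^ q • (B ^ q * A) := by
  induction q with
  | zero => simp
  | succ q ih =>
    rw [pow_succ, ← Matrix.mul_assoc, ih, Matrix.smul_mul, Matrix.mul_assoc, hAB, Matrix.mul_smul,
      ← Matrix.mul_assoc, smul_smul, pow_succ', mul_comm ω (ω ^ q)]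

/-- A unimodular phase drops out of a conjugation: `(c·W) M (c·W)ᴴ = W M Wᴴ` for `c̄c = 1`. [cite: tHooft1979Flux, §3] -/
theorem smul_conj_eq (W M : Matrix (Fin N) (Fin N) ℂ) {c : ℂ} (hc : starRingEnd ℂ c * c = 1) :
    (c • W) * M * (c • W)ᴴ = W * M * Wᴴ := by
  rw [Matrix.conjTranspose_smul, Matrix.smul_mul, Matrix.smul_mul, Matrix.mul_smul, smul_smul, Complex.star_def,
    mul_comm c, hc, one_smul]

/-- For a primitive `N`-th root of unity, `conj(ω^q) ω^q = 1`. [cite: tHooft1979Flux, §3] -/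
theorem conj_pow_mul_pow_eq_one [NeZero N] (hω : IsPrimitiveRoot ω N) (q : ℕ) :
    starRingEnd ℂ (ω ^ q) * ω ^ q = 1 := by
  rw [Complex.conj_mul', norm_pow, hω.norm'_eq_one (NeZero.ne N), one_pow, Complex.ofReal_one, one_pow]

/-- The accumulated transition function is unitary. [cite: tHooft1979Flux, §3] -/
theorem ladderTransition_mem_unitaryGroup (hAu : A ∈ Matrix.unitaryGroup (Fin N) ℂ)
    (hBu : B ∈ Matrix.unitaryGroup (Fin N) ℂ) (y₀ y₁ : ℕ) :
    ladderTransition A B ℓ y₀ y₁ ∈ Matrix.unitaryGroup (Fin N) ℂ :=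
  mul_mem (pow_mem hAu _) (pow_mem hBu _)

/-- `Ω(y)ᴴ Ω(y) = 1`. [cite: tHooft1979Flux, §3] -/
theorem conjTranspose_ladderTransition_mul_self (hAu : A ∈ Matrix.unitaryGroup (Fin N) ℂ)
    (hBu : B ∈ Matrix.unitaryGroup (Fin N) ℂ) (y₀ y₁ : ℕ) :
    (ladderTransition A B ℓ y₀ y₁)ᴴ * ladderTransition A B ℓ y₀ y₁ = 1 :=
  (ladderTransition_mem_unitaryGroup hAu hBu y₀ y₁).1

/-- One period in direction `0` adds a factor `A` on the left: `Ω(y₀+ℓ, y₁) = A Ω(y)`. [cite: tHooft1979Flux, §3] -/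
theorem ladderTransition_add_left (hℓ : 0 < ℓ) (y₀ y₁ : ℕ) :
    ladderTransition A B ℓ (y₀ + ℓ) y₁ = A * ladderTransition A B ℓ y₀ y₁ := by
  rw [ladderTransition_def, ladderTransition_def, Nat.add_div_right _ hℓ, pow_succ', Matrix.mul_assoc]

/-- One period in direction `1`: `Ω(y₀, y₁+ℓ) = ω^{⌊y₀/ℓ⌋} · B Ω(y)` (the transition functions commute up to the twist).
[cite: tHooft1979Flux, §3] -/
theorem ladderTransition_add_right (hAB : A * B = ω • (B * A)) (hℓ : 0 < ℓ) (y₀ y₁ : ℕ) :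
    ladderTransition A B ℓ y₀ (y₁ + ℓ) = ω ^ (y₀ / ℓ) • (B * ladderTransition A B ℓ y₀ y₁) := by
  rw [ladderTransition_def, ladderTransition_def, Nat.add_div_right _ hℓ, pow_succ', ← Matrix.mul_assoc,
    pow_mul_eq_smul_of_weyl hAB, Matrix.smul_mul, Matrix.mul_assoc]

/-- Crossing the `A`-sheet: if `ℓ ∣ y₀ + 1` then `Ω(y₀+1, y₁) = ω^{⌊y₁/ℓ⌋} · Ω(y) A`. [cite: tHooft1979Flux, §3] -/
theorem ladderTransition_succ_left_of_dvd (hAB : A * B = ω • (B * A)) {y₀ : ℕ} (h : ℓ ∣ y₀ + 1) (y₁ : ℕ) :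
    ladderTransition A B ℓ (y₀ + 1) y₁ = ω ^ (y₁ / ℓ) • (ladderTransition A B ℓ y₀ y₁ * A) := by
  rw [ladderTransition_def, ladderTransition_def, Nat.succ_div_of_dvd h, pow_succ, Matrix.mul_assoc,
    mul_pow_eq_smul_of_weyl hAB, Matrix.mul_smul, Matrix.mul_assoc]

/-- Crossing the `B`-sheet: if `ℓ ∣ y₁ + 1` then `Ω(y₀, y₁+1) = Ω(y) B`. [cite: tHooft1979Flux, §3] -/
theorem ladderTransition_succ_right_of_dvd {y₁ : ℕ} (h : ℓ ∣ y₁ + 1) (y₀ : ℕ) :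
    ladderTransition A B ℓ y₀ (y₁ + 1) = ladderTransition A B ℓ y₀ y₁ * B := by
  rw [ladderTransition_def, ladderTransition_def, Nat.succ_div_of_dvd h, pow_succ, Matrix.mul_assoc]

/-- Away from the `A`-sheet `Ω` is constant in `y₀`. [cite: tHooft1979Flux, §3] -/
theorem ladderTransition_succ_left_of_not_dvd {y₀ : ℕ} (h : ¬ℓ ∣ y₀ + 1) (y₁ : ℕ) :
    ladderTransition A B ℓ (y₀ + 1) y₁ = ladderTransition A B ℓ y₀ y₁ := by
  rw [ladderTransition_def, ladderTransition_def, Nat.succ_div_of_not_dvd h]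

/-- Away from the `B`-sheet `Ω` is constant in `y₁`. [cite: tHooft1979Flux, §3] -/
theorem ladderTransition_succ_right_of_not_dvd {y₁ : ℕ} (h : ¬ℓ ∣ y₁ + 1) (y₀ : ℕ) :
    ladderTransition A B ℓ y₀ (y₁ + 1) = ladderTransition A B ℓ y₀ y₁ := by
  rw [ladderTransition_def, ladderTransition_def, Nat.succ_div_of_not_dvd h]

variable [NeZero ℓ]

omit [NeZero ℓ] in
/-- `(y + ℓ + 1) mod ℓ = (y + 1) mod ℓ` in `Fin ℓ`. [folklore] -/
private theorem ofNat_add_period [NeZero ℓ] (y : ℕ) : (Fin.ofNat ℓ (y + ℓ + 1)) = (Fin.ofNat ℓ (y + 1)) := by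
  ext; simp [Nat.add_right_comm y ℓ 1]

omit [NeZero ℓ] in
/-- `(y + 2) mod ℓ = ((y + 1) mod ℓ) + 1` in `Fin ℓ`. [folklore] -/
private theorem ofNat_succ_succ [NeZero ℓ] (y : ℕ) : (Fin.ofNat ℓ (y + 1 + 1)) = (Fin.ofNat ℓ (y + 1)) + 1 := by
  ext; simp [Fin.val_add, Nat.add_mod]

omit [NeZero ℓ] in
/-- `(y + 1) mod ℓ = 0 ↔ ℓ ∣ y + 1`. [folklore] -/
private theorem ofNat_succ_eq_zero_iff [NeZero ℓ] (y : ℕ) : (Fin.ofNat ℓ (y + 1)) = 0 ↔ ℓ ∣ y + 1 := by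
  simp [Fin.ext_iff, Nat.dvd_iff_mod_eq_zero]

omit [NeZero ℓ] in
/-- `(i + 1) mod ℓ = i + 1` in `Fin ℓ` for `i : Fin ℓ`. [folklore] -/
private theorem ofNat_val_succ [NeZero ℓ] (i : Fin ℓ) : ((Fin.ofNat ℓ (↑i + 1))) = i + 1 := by
  ext; simp [Fin.val_add]

/-- ★ **Twisted periodicity of the lift in direction `0`**: `Φ̃(y₀+ℓ, y₁) = A Φ̃(y) Aᴴ`. [cite: Gonzalezarroyo1998, §3, §8.1] -/
theorem ladderLift_add_left (Φ : Fin ℓ → Fin ℓ → Matrix (Fin N) (Fin N) ℂ) (y₀ y₁ : ℕ) :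
    ladderLift A B ℓ Φ (y₀ + ℓ) y₁ = A * ladderLift A B ℓ Φ y₀ y₁ * Aᴴ := by
  have hcast : (Fin.ofNat ℓ (y₀ + ℓ + 1)) = (Fin.ofNat ℓ (y₀ + 1)) := ofNat_add_period y₀
  rw [ladderLift_def, ladderLift_def, hcast, ladderTransition_add_left (Nat.pos_of_ne_zero (NeZero.ne ℓ)),
    Matrix.conjTranspose_mul]
  simp only [Matrix.mul_assoc]

/-- ★ **Twisted periodicity of the lift in direction `1`**: `Φ̃(y₀, y₁+ℓ) = B Φ̃(y) Bᴴ` (the phase `ω^{⌊y₀/ℓ⌋}` of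
`Ω_0Ω_1 = z Ω_1Ω_0` drops out of the adjoint action). [cite: Gonzalezarroyo1998, §3, §8.1] [cite: tHooft1979Flux, §3] -/
theorem ladderLift_add_right [NeZero N] (hω : IsPrimitiveRoot ω N) (hAB : A * B = ω • (B * A))
    (Φ : Fin ℓ → Fin ℓ → Matrix (Fin N) (Fin N) ℂ) (y₀ y₁ : ℕ) :
    ladderLift A B ℓ Φ y₀ (y₁ + ℓ) = B * ladderLift A B ℓ Φ y₀ y₁ * Bᴴ := by
  have hcast : (Fin.ofNat ℓ (y₁ + ℓ + 1)) = (Fin.ofNat ℓ (y₁ + 1)) := ofNat_add_period y₁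
  rw [ladderLift_def, ladderLift_def, hcast, ladderTransition_add_right hAB (Nat.pos_of_ne_zero (NeZero.ne ℓ)),
    smul_conj_eq _ _ (conj_pow_mul_pow_eq_one hω _), Matrix.conjTranspose_mul]
  simp only [Matrix.mul_assoc]

/-- The lift of a traceless field is traceless. [cite: GarciaperezGonzalezarroyoOkawa2014, §3] -/
theorem trace_ladderLift (hAu : A ∈ Matrix.unitaryGroup (Fin N) ℂ) (hBu : B ∈ Matrix.unitaryGroup (Fin N) ℂ)
    {Φ : Fin ℓ → Fin ℓ → Matrix (Fin N) (Fin N) ℂ} (htr : ∀ x₀ x₁, (Φ x₀ x₁).trace = 0) (y₀ y₁ : ℕ) :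
    (ladderLift A B ℓ Φ y₀ y₁).trace = 0 := by
  rw [ladderLift_def, Matrix.trace_mul_cycle, conjTranspose_ladderTransition_mul_self hAu hBu, Matrix.one_mul, htr]

/-- The lift preserves the Hilbert–Schmidt energy sitewise: `S(Φ̃(y)) = S(Φ((y₀+1) mod ℓ, (y₁+1) mod ℓ))`.
[cite: GarciaperezGonzalezarroyoOkawa2014, §3] -/
theorem energy_ladderLift (hAu : A ∈ Matrix.unitaryGroup (Fin N) ℂ) (hBu : B ∈ Matrix.unitaryGroup (Fin N) ℂ)
    (Φ : Fin ℓ → Fin ℓ → Matrix (Fin N) (Fin N) ℂ) (y₀ y₁ : ℕ) :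
    (((ladderLift A B ℓ Φ y₀ y₁)ᴴ * ladderLift A B ℓ Φ y₀ y₁).trace).re =
      (((Φ (Fin.ofNat ℓ (y₀ + 1)) (Fin.ofNat ℓ (y₁ + 1)))ᴴ * Φ (Fin.ofNat ℓ (y₀ + 1)) (Fin.ofNat ℓ (y₁ + 1))).trace).re := by
  rw [ladderLift_def]
  exact re_trace_conjTranspose_mul_self_conj (conjTranspose_ladderTransition_mul_self hAu hBu y₀ y₁) _

/-- ★ **Covariant ↔ plain differences, direction `0`.**  With the ladder links `U₀(0, x₁) = A`, `U₀(x₀, x₁) = 1` for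
`x₀ ≠ 0`, the plain forward difference of the lift is the conjugated covariant difference of the field:
`Φ̃(y₀+1, y₁) − Φ̃(y) = Ω(y) · (U₀(x) Φ(x+e₀) U₀(x)ᴴ − Φ(x)) · Ω(y)ᴴ`, `x = ((y₀+1) mod ℓ, (y₁+1) mod ℓ)`
(`∇_μ⁺Φ(n) = Γ_μ(n)Φ(n+μ̂)Γ_μ(n)† − Φ(n)`). [cite: GarciaperezGonzalezarroyoOkawa2017, §2.3] [cite: Gonzalezarroyo1998, §3, §8.1] -/
theorem ladderLift_succ_left_sub [NeZero N] (hω : IsPrimitiveRoot ω N) (hAB : A * B = ω • (B * A))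
    {U₀ : Fin ℓ → Fin ℓ → Matrix (Fin N) (Fin N) ℂ} (hU₀z : ∀ x₁, U₀ 0 x₁ = A)
    (hU₀ : ∀ x₀ x₁, x₀ ≠ 0 → U₀ x₀ x₁ = 1) (Φ : Fin ℓ → Fin ℓ → Matrix (Fin N) (Fin N) ℂ) (y₀ y₁ : ℕ) :
    ladderLift A B ℓ Φ (y₀ + 1) y₁ - ladderLift A B ℓ Φ y₀ y₁ =
      ladderTransition A B ℓ y₀ y₁ *
        (U₀ (Fin.ofNat ℓ (y₀ + 1)) (Fin.ofNat ℓ (y₁ + 1)) * Φ ((Fin.ofNat ℓ (y₀ + 1)) + 1) (Fin.ofNat ℓ (y₁ + 1)) *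
            (U₀ (Fin.ofNat ℓ (y₀ + 1)) (Fin.ofNat ℓ (y₁ + 1)))ᴴ -
          Φ (Fin.ofNat ℓ (y₀ + 1)) (Fin.ofNat ℓ (y₁ + 1))) *
        (ladderTransition A B ℓ y₀ y₁)ᴴ := by
  have hcast : (Fin.ofNat ℓ (y₀ + 1 + 1)) = (Fin.ofNat ℓ (y₀ + 1)) + 1 := ofNat_succ_succ y₀
  rw [ladderLift_def, ladderLift_def, hcast]
  by_cases h : ℓ ∣ y₀ + 1
  · have hx : (Fin.ofNat ℓ (y₀ + 1)) = 0 := Fin.natCast_eq_zero.mpr h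
    rw [ladderTransition_succ_left_of_dvd hAB h, smul_conj_eq _ _ (conj_pow_mul_pow_eq_one hω _), hx, hU₀z,
      Matrix.conjTranspose_mul]
    simp only [Matrix.mul_sub, Matrix.sub_mul, Matrix.mul_assoc]
  · have hx : (Fin.ofNat ℓ (y₀ + 1)) ≠ 0 := fun h' => h (Fin.natCast_eq_zero.mp h')
    rw [ladderTransition_succ_left_of_not_dvd h, hU₀ _ _ hx, Matrix.conjTranspose_one, Matrix.one_mul,
      Matrix.mul_one]
    simp only [Matrix.mul_sub, Matrix.sub_mul]

/-- ★ **Covariant ↔ plain differences, direction `1`** (`U₁(x₀, 0) = B`, `U₁(x₀, x₁) = 1` for `x₁ ≠ 0`):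
`Φ̃(y₀, y₁+1) − Φ̃(y) = Ω(y) · (U₁(x) Φ(x+e₁) U₁(x)ᴴ − Φ(x)) · Ω(y)ᴴ`.
[cite: GarciaperezGonzalezarroyoOkawa2017, §2.3] [cite: Gonzalezarroyo1998, §3, §8.1] -/
theorem ladderLift_succ_right_sub {U₁ : Fin ℓ → Fin ℓ → Matrix (Fin N) (Fin N) ℂ} (hU₁z : ∀ x₀, U₁ x₀ 0 = B)
    (hU₁ : ∀ x₀ x₁, x₁ ≠ 0 → U₁ x₀ x₁ = 1) (Φ : Fin ℓ → Fin ℓ → Matrix (Fin N) (Fin N) ℂ) (y₀ y₁ : ℕ) :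
    ladderLift A B ℓ Φ y₀ (y₁ + 1) - ladderLift A B ℓ Φ y₀ y₁ =
      ladderTransition A B ℓ y₀ y₁ *
        (U₁ (Fin.ofNat ℓ (y₀ + 1)) (Fin.ofNat ℓ (y₁ + 1)) * Φ (Fin.ofNat ℓ (y₀ + 1)) ((Fin.ofNat ℓ (y₁ + 1)) + 1) *
            (U₁ (Fin.ofNat ℓ (y₀ + 1)) (Fin.ofNat ℓ (y₁ + 1)))ᴴ -
          Φ (Fin.ofNat ℓ (y₀ + 1)) (Fin.ofNat ℓ (y₁ + 1))) *
        (ladderTransition A B ℓ y₀ y₁)ᴴ := by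
  have hcast : (Fin.ofNat ℓ (y₁ + 1 + 1)) = (Fin.ofNat ℓ (y₁ + 1)) + 1 := ofNat_succ_succ y₁
  rw [ladderLift_def, ladderLift_def, hcast]
  by_cases h : ℓ ∣ y₁ + 1
  · have hx : (Fin.ofNat ℓ (y₁ + 1)) = 0 := Fin.natCast_eq_zero.mpr h
    rw [ladderTransition_succ_right_of_dvd h, hx, hU₁z, Matrix.conjTranspose_mul]
    simp only [Matrix.mul_sub, Matrix.sub_mul, Matrix.mul_assoc]
  · have hx : (Fin.ofNat ℓ (y₁ + 1)) ≠ 0 := fun h' => h (Fin.natCast_eq_zero.mp h')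
    rw [ladderTransition_succ_right_of_not_dvd h, hU₁ _ _ hx, Matrix.conjTranspose_one, Matrix.one_mul,
      Matrix.mul_one]
    simp only [Matrix.mul_sub, Matrix.sub_mul]

/-- Energy form of the direction-`0` dictionary: `S(Φ̃(y₀+1,y₁) − Φ̃(y)) = S(D₀Φ(x))`.
[cite: GarciaperezGonzalezarroyoOkawa2014, §3] [cite: GarciaperezGonzalezarroyoOkawa2017, §2.3] -/
theorem energy_ladderLift_succ_left_sub [NeZero N] (hAu : A ∈ Matrix.unitaryGroup (Fin N) ℂ)
    (hBu : B ∈ Matrix.unitaryGroup (Fin N) ℂ) (hω : IsPrimitiveRoot ω N) (hAB : A * B = ω • (B * A))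
    {U₀ : Fin ℓ → Fin ℓ → Matrix (Fin N) (Fin N) ℂ} (hU₀z : ∀ x₁, U₀ 0 x₁ = A)
    (hU₀ : ∀ x₀ x₁, x₀ ≠ 0 → U₀ x₀ x₁ = 1) (Φ : Fin ℓ → Fin ℓ → Matrix (Fin N) (Fin N) ℂ) (y₀ y₁ : ℕ) :
    (((ladderLift A B ℓ Φ (y₀ + 1) y₁ - ladderLift A B ℓ Φ y₀ y₁)ᴴ *
        (ladderLift A B ℓ Φ (y₀ + 1) y₁ - ladderLift A B ℓ Φ y₀ y₁)).trace).re =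
      (((U₀ (Fin.ofNat ℓ (y₀ + 1)) (Fin.ofNat ℓ (y₁ + 1)) * Φ ((Fin.ofNat ℓ (y₀ + 1)) + 1) (Fin.ofNat ℓ (y₁ + 1)) *
            (U₀ (Fin.ofNat ℓ (y₀ + 1)) (Fin.ofNat ℓ (y₁ + 1)))ᴴ -
          Φ (Fin.ofNat ℓ (y₀ + 1)) (Fin.ofNat ℓ (y₁ + 1)))ᴴ *
        (U₀ (Fin.ofNat ℓ (y₀ + 1)) (Fin.ofNat ℓ (y₁ + 1)) * Φ ((Fin.ofNat ℓ (y₀ + 1)) + 1) (Fin.ofNat ℓ (y₁ + 1)) *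
            (U₀ (Fin.ofNat ℓ (y₀ + 1)) (Fin.ofNat ℓ (y₁ + 1)))ᴴ -
          Φ (Fin.ofNat ℓ (y₀ + 1)) (Fin.ofNat ℓ (y₁ + 1)))).trace).re := by
  rw [ladderLift_succ_left_sub hω hAB hU₀z hU₀]
  exact re_trace_conjTranspose_mul_self_conj (conjTranspose_ladderTransition_mul_self hAu hBu y₀ y₁) _

/-- Energy form of the direction-`1` dictionary: `S(Φ̃(y₀,y₁+1) − Φ̃(y)) = S(D₁Φ(x))`.
[cite: GarciaperezGonzalezarroyoOkawa2014, §3] [cite: GarciaperezGonzalezarroyoOkawa2017, §2.3] -/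
theorem energy_ladderLift_succ_right_sub (hAu : A ∈ Matrix.unitaryGroup (Fin N) ℂ)
    (hBu : B ∈ Matrix.unitaryGroup (Fin N) ℂ) {U₁ : Fin ℓ → Fin ℓ → Matrix (Fin N) (Fin N) ℂ}
    (hU₁z : ∀ x₀, U₁ x₀ 0 = B) (hU₁ : ∀ x₀ x₁, x₁ ≠ 0 → U₁ x₀ x₁ = 1)
    (Φ : Fin ℓ → Fin ℓ → Matrix (Fin N) (Fin N) ℂ) (y₀ y₁ : ℕ) :
    (((ladderLift A B ℓ Φ y₀ (y₁ + 1) - ladderLift A B ℓ Φ y₀ y₁)ᴴ *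
        (ladderLift A B ℓ Φ y₀ (y₁ + 1) - ladderLift A B ℓ Φ y₀ y₁)).trace).re =
      (((U₁ (Fin.ofNat ℓ (y₀ + 1)) (Fin.ofNat ℓ (y₁ + 1)) * Φ (Fin.ofNat ℓ (y₀ + 1)) ((Fin.ofNat ℓ (y₁ + 1)) + 1) *
            (U₁ (Fin.ofNat ℓ (y₀ + 1)) (Fin.ofNat ℓ (y₁ + 1)))ᴴ -
          Φ (Fin.ofNat ℓ (y₀ + 1)) (Fin.ofNat ℓ (y₁ + 1)))ᴴ *
        (U₁ (Fin.ofNat ℓ (y₀ + 1)) (Fin.ofNat ℓ (y₁ + 1)) * Φ (Fin.ofNat ℓ (y₀ + 1)) ((Fin.ofNat ℓ (y₁ + 1)) + 1) *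
            (U₁ (Fin.ofNat ℓ (y₀ + 1)) (Fin.ofNat ℓ (y₁ + 1)))ᴴ -
          Φ (Fin.ofNat ℓ (y₀ + 1)) (Fin.ofNat ℓ (y₁ + 1)))).trace).re := by
  rw [ladderLift_succ_right_sub hU₁z hU₁]
  exact re_trace_conjTranspose_mul_self_conj (conjTranspose_ladderTransition_mul_self hAu hBu y₀ y₁) _

/-- Relabelling the fundamental domain: `Σ_{y<ℓ} f((y+1) mod ℓ) = Σ_{x : Fin ℓ} f x`. [cite: Gonzalezarroyo1998, §3, §8.1] -/
theorem sum_range_natCast_succ {M : Type*} [AddCommMonoid M] (f : Fin ℓ → M) :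
    ∑ y ∈ range ℓ, f (Fin.ofNat ℓ (y + 1)) = ∑ x : Fin ℓ, f x := by
  rw [Finset.sum_range]
  simp_rw [ofNat_val_succ]
  exact Fintype.sum_equiv (Equiv.addRight 1) _ _ fun _ => rfl

end Dictionary

/-! ## §3 The covariant Laplacian gap at the ladder background -/

section Gap

variable [NeZero N] {A B : Matrix (Fin N) (Fin N) ℂ} {ω : ℂ} {ℓ : ℕ} [NeZero ℓ]

/-- ★ **Sharp Poincaré inequality at the ladder background, `ℓ × ℓ` periodic `Fin` torus.**  For a unitary Weyl pair
`AB = ω·BA` (`ω` a primitive `N`-th root of unity), ladder links `U₀ = A` on the sheet `x₀ = 0`, `U₁ = B` on `x₁ = 0`, `1`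
elsewhere, and every traceless adjoint field `Φ` on the torus:
`4 sin²(π/(Nℓ)) · Σ_x S(Φ x) ≤ Σ_x [S(U₀(x)Φ(x+e₀)U₀(x)ᴴ − Φ(x)) + S(U₁(x)Φ(x+e₁)U₁(x)ᴴ − Φ(x))]` — the twisted-periodic
statement `twistedTorus_poincare_sharp` transported through the lift. [cite: GarciaperezGonzalezarroyoOkawa2014, §3]
[cite: Gonzalezarroyo1998, §3, §8.1] -/
theorem ladder_poincare_sharp (hAu : A ∈ Matrix.unitaryGroup (Fin N) ℂ) (hBu : B ∈ Matrix.unitaryGroup (Fin N) ℂ)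
    (hω : IsPrimitiveRoot ω N) (hAB : A * B = ω • (B * A)) {Φ : Fin ℓ → Fin ℓ → Matrix (Fin N) (Fin N) ℂ}
    (htr : ∀ x₀ x₁, (Φ x₀ x₁).trace = 0) {U₀ U₁ : Fin ℓ → Fin ℓ → Matrix (Fin N) (Fin N) ℂ}
    (hU₀z : ∀ x₁, U₀ 0 x₁ = A) (hU₀ : ∀ x₀ x₁, x₀ ≠ 0 → U₀ x₀ x₁ = 1) (hU₁z : ∀ x₀, U₁ x₀ 0 = B)
    (hU₁ : ∀ x₀ x₁, x₁ ≠ 0 → U₁ x₀ x₁ = 1) :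
    4 * Real.sin (Real.pi / ((N : ℝ) * ℓ)) ^ 2 * ∑ x₀ : Fin ℓ, ∑ x₁ : Fin ℓ, (((Φ x₀ x₁)ᴴ * Φ x₀ x₁).trace).re ≤
      ∑ x₀ : Fin ℓ, ∑ x₁ : Fin ℓ,
        ((((U₀ x₀ x₁ * Φ (x₀ + 1) x₁ * (U₀ x₀ x₁)ᴴ - Φ x₀ x₁)ᴴ *
              (U₀ x₀ x₁ * Φ (x₀ + 1) x₁ * (U₀ x₀ x₁)ᴴ - Φ x₀ x₁)).trace).re +
          (((U₁ x₀ x₁ * Φ x₀ (x₁ + 1) * (U₁ x₀ x₁)ᴴ - Φ x₀ x₁)ᴴ *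
              (U₁ x₀ x₁ * Φ x₀ (x₁ + 1) * (U₁ x₀ x₁)ᴴ - Φ x₀ x₁)).trace).re) := by
  have H := twistedTorus_poincare_sharp (Φ := ladderLift A B ℓ Φ) hAu hBu hω hAB (ladderLift_add_left Φ)
    (ladderLift_add_right hω hAB Φ) (trace_ladderLift hAu hBu htr)
  simp_rw [energy_ladderLift hAu hBu, energy_ladderLift_succ_left_sub hAu hBu hω hAB hU₀z hU₀,
    energy_ladderLift_succ_right_sub hAu hBu hU₁z hU₁] at H
  have hL : ∑ y₀ ∈ range ℓ, ∑ y₁ ∈ range ℓ,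
      (((Φ (Fin.ofNat ℓ (y₀ + 1)) (Fin.ofNat ℓ (y₁ + 1)))ᴴ * Φ (Fin.ofNat ℓ (y₀ + 1)) (Fin.ofNat ℓ (y₁ + 1))).trace).re =
      ∑ x₀ : Fin ℓ, ∑ x₁ : Fin ℓ, (((Φ x₀ x₁)ᴴ * Φ x₀ x₁).trace).re := by
    rw [sum_range_natCast_succ (f := fun x₀ => ∑ y₁ ∈ range ℓ,
      (((Φ x₀ (Fin.ofNat ℓ (y₁ + 1)))ᴴ * Φ x₀ (Fin.ofNat ℓ (y₁ + 1))).trace).re)]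
    exact Finset.sum_congr rfl fun x₀ _ =>
      sum_range_natCast_succ (f := fun x₁ => (((Φ x₀ x₁)ᴴ * Φ x₀ x₁).trace).re)
  have hR : ∑ y₀ ∈ range ℓ, ∑ y₁ ∈ range ℓ,
      ((((U₀ (Fin.ofNat ℓ (y₀ + 1)) (Fin.ofNat ℓ (y₁ + 1)) * Φ ((Fin.ofNat ℓ (y₀ + 1)) + 1) (Fin.ofNat ℓ (y₁ + 1)) *
              (U₀ (Fin.ofNat ℓ (y₀ + 1)) (Fin.ofNat ℓ (y₁ + 1)))ᴴ - Φ (Fin.ofNat ℓ (y₀ + 1)) (Fin.ofNat ℓ (y₁ + 1)))ᴴ *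
            (U₀ (Fin.ofNat ℓ (y₀ + 1)) (Fin.ofNat ℓ (y₁ + 1)) * Φ ((Fin.ofNat ℓ (y₀ + 1)) + 1) (Fin.ofNat ℓ (y₁ + 1)) *
              (U₀ (Fin.ofNat ℓ (y₀ + 1)) (Fin.ofNat ℓ (y₁ + 1)))ᴴ - Φ (Fin.ofNat ℓ (y₀ + 1)) (Fin.ofNat ℓ (y₁ + 1)))).trace).re +
        (((U₁ (Fin.ofNat ℓ (y₀ + 1)) (Fin.ofNat ℓ (y₁ + 1)) * Φ (Fin.ofNat ℓ (y₀ + 1)) ((Fin.ofNat ℓ (y₁ + 1)) + 1) *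
              (U₁ (Fin.ofNat ℓ (y₀ + 1)) (Fin.ofNat ℓ (y₁ + 1)))ᴴ - Φ (Fin.ofNat ℓ (y₀ + 1)) (Fin.ofNat ℓ (y₁ + 1)))ᴴ *
            (U₁ (Fin.ofNat ℓ (y₀ + 1)) (Fin.ofNat ℓ (y₁ + 1)) * Φ (Fin.ofNat ℓ (y₀ + 1)) ((Fin.ofNat ℓ (y₁ + 1)) + 1) *
              (U₁ (Fin.ofNat ℓ (y₀ + 1)) (Fin.ofNat ℓ (y₁ + 1)))ᴴ - Φ (Fin.ofNat ℓ (y₀ + 1)) (Fin.ofNat ℓ (y₁ + 1)))).trace).re) =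
      ∑ x₀ : Fin ℓ, ∑ x₁ : Fin ℓ,
        ((((U₀ x₀ x₁ * Φ (x₀ + 1) x₁ * (U₀ x₀ x₁)ᴴ - Φ x₀ x₁)ᴴ *
              (U₀ x₀ x₁ * Φ (x₀ + 1) x₁ * (U₀ x₀ x₁)ᴴ - Φ x₀ x₁)).trace).re +
          (((U₁ x₀ x₁ * Φ x₀ (x₁ + 1) * (U₁ x₀ x₁)ᴴ - Φ x₀ x₁)ᴴ *
              (U₁ x₀ x₁ * Φ x₀ (x₁ + 1) * (U₁ x₀ x₁)ᴴ - Φ x₀ x₁)).trace).re) := by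
    rw [sum_range_natCast_succ (f := fun x₀ => ∑ y₁ ∈ range ℓ,
      ((((U₀ x₀ (Fin.ofNat ℓ (y₁ + 1)) * Φ (x₀ + 1) (Fin.ofNat ℓ (y₁ + 1)) * (U₀ x₀ (Fin.ofNat ℓ (y₁ + 1)))ᴴ -
            Φ x₀ (Fin.ofNat ℓ (y₁ + 1)))ᴴ *
          (U₀ x₀ (Fin.ofNat ℓ (y₁ + 1)) * Φ (x₀ + 1) (Fin.ofNat ℓ (y₁ + 1)) * (U₀ x₀ (Fin.ofNat ℓ (y₁ + 1)))ᴴ -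
            Φ x₀ (Fin.ofNat ℓ (y₁ + 1)))).trace).re +
        (((U₁ x₀ (Fin.ofNat ℓ (y₁ + 1)) * Φ x₀ ((Fin.ofNat ℓ (y₁ + 1)) + 1) * (U₁ x₀ (Fin.ofNat ℓ (y₁ + 1)))ᴴ -
            Φ x₀ (Fin.ofNat ℓ (y₁ + 1)))ᴴ *
          (U₁ x₀ (Fin.ofNat ℓ (y₁ + 1)) * Φ x₀ ((Fin.ofNat ℓ (y₁ + 1)) + 1) * (U₁ x₀ (Fin.ofNat ℓ (y₁ + 1)))ᴴ -
            Φ x₀ (Fin.ofNat ℓ (y₁ + 1)))).trace).re))]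
    exact Finset.sum_congr rfl fun x₀ _ => sum_range_natCast_succ (f := fun x₁ =>
      ((((U₀ x₀ x₁ * Φ (x₀ + 1) x₁ * (U₀ x₀ x₁)ᴴ - Φ x₀ x₁)ᴴ *
            (U₀ x₀ x₁ * Φ (x₀ + 1) x₁ * (U₀ x₀ x₁)ᴴ - Φ x₀ x₁)).trace).re +
        (((U₁ x₀ x₁ * Φ x₀ (x₁ + 1) * (U₁ x₀ x₁)ᴴ - Φ x₀ x₁)ᴴ *
            (U₁ x₀ x₁ * Φ x₀ (x₁ + 1) * (U₁ x₀ x₁)ᴴ - Φ x₀ x₁)).trace).re))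
  rw [hL, hR] at H
  exact H

omit [NeZero N] [NeZero ℓ] in
/-- Slicing the four-dimensional box along the untwisted coordinates: `Σ_x f(x) = Σ_{(u,v)} Σ_{x₀} Σ_{x₁} f(x₀,x₁,u,v)`.
[folklore] -/
private theorem sum_finTorusSite_slices {L₂ L₃ : ℕ} {M : Type*} [AddCommMonoid M] {f : FinTorusSite ℓ ℓ L₂ L₃ → M} :
    ∑ x, f x = ∑ p : Fin L₂ × Fin L₃, ∑ x₀ : Fin ℓ, ∑ x₁ : Fin ℓ, f (x₀, x₁, p.1, p.2) := by
  let e : (Fin L₂ × Fin L₃) × (Fin ℓ × Fin ℓ) ≃ FinTorusSite ℓ ℓ L₂ L₃ :=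
    ⟨fun z => (z.2.1, z.2.2, z.1.1, z.1.2), fun x => ((x.2.2.1, x.2.2.2), (x.1, x.2.1)), fun _ => rfl, fun _ => rfl⟩
  rw [← Fintype.sum_equiv e (fun z => f (e z)) f (fun _ => rfl), Fintype.sum_prod_type]
  refine Finset.sum_congr rfl fun q _ => ?_
  rw [Fintype.sum_prod_type]
  rfl

/-- ★★ **The covariant Laplacian of the twist-eating ladder has the 0-form gap `4 sin²(π/(Nℓ))`, uniformly in the
untwisted extents** — in the `Fin`-box currency of the twisted slab line.  On the anisotropic periodic box
`ℓ × ℓ × L₂ × L₃` (`FinTorusSite`, neighbours by `FinTorusSite.shift`), for ANY link field `U` whose `0`-links are `A` on the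
sheet `x₀ = 0` and `1` off it and whose `1`-links are `B` on `x₁ = 0` and `1` off it (NO hypothesis on the `2`- and `3`-links:
the ladder's central links, or anything), and every traceless adjoint field `Φ`:
`4 sin²(π/(Nℓ)) · Σ_x S(Φ x) ≤ Σ_x Σ_{μ<4} S(U(x,μ) Φ(x+e_μ) U(x,μ)ᴴ − Φ(x))` — the hypothesis `hm` of
`DiscreteWeitzenboeck.gap_of_div_eq_zero` for the ladder background, with `m = 4 sin²(π/(Nℓ))` independent of `L₂, L₃`
(«momentum quantized in units of `2π/(N l_μ)` … excluding zero»). [cite: GarciaperezGonzalezarroyoOkawa2014, §3]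
[cite: GarciaperezGonzalezarroyoOkawa2017, §2.2–§2.3] -/
theorem ladder_finTorus_poincare_sharp {L₂ L₃ : ℕ} (hAu : A ∈ Matrix.unitaryGroup (Fin N) ℂ)
    (hBu : B ∈ Matrix.unitaryGroup (Fin N) ℂ) (hω : IsPrimitiveRoot ω N) (hAB : A * B = ω • (B * A))
    {Φ : FinTorusSite ℓ ℓ L₂ L₃ → Matrix (Fin N) (Fin N) ℂ} (htr : ∀ x, (Φ x).trace = 0)
    {U : FinTorusSite ℓ ℓ L₂ L₃ × Fin 4 → Matrix (Fin N) (Fin N) ℂ}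
    (hU0z : ∀ x, finTorusSiteCoord x 0 = 0 → U (x, 0) = A) (hU0 : ∀ x, finTorusSiteCoord x 0 ≠ 0 → U (x, 0) = 1)
    (hU1z : ∀ x, finTorusSiteCoord x 1 = 0 → U (x, 1) = B) (hU1 : ∀ x, finTorusSiteCoord x 1 ≠ 0 → U (x, 1) = 1) :
    4 * Real.sin (Real.pi / ((N : ℝ) * ℓ)) ^ 2 * ∑ x : FinTorusSite ℓ ℓ L₂ L₃, (((Φ x)ᴴ * Φ x).trace).re ≤
      ∑ x : FinTorusSite ℓ ℓ L₂ L₃, ∑ μ : Fin 4,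
        (((U (x, μ) * Φ (x.shift μ) * (U (x, μ))ᴴ - Φ x)ᴴ * (U (x, μ) * Φ (x.shift μ) * (U (x, μ))ᴴ - Φ x)).trace).re := by
  -- abbreviate the covariant-difference energy
  set T : FinTorusSite ℓ ℓ L₂ L₃ → Fin 4 → ℝ := fun x μ =>
    (((U (x, μ) * Φ (x.shift μ) * (U (x, μ))ᴴ - Φ x)ᴴ * (U (x, μ) * Φ (x.shift μ) * (U (x, μ))ᴴ - Φ x)).trace).re
    with hT
  have hTnn : ∀ x μ, 0 ≤ T x μ := fun x μ => re_trace_conjTranspose_mul_self_nonneg _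
  -- keep only the two twisted directions
  have hdrop : ∑ x : FinTorusSite ℓ ℓ L₂ L₃, (T x 0 + T x 1) ≤ ∑ x : FinTorusSite ℓ ℓ L₂ L₃, ∑ μ : Fin 4, T x μ := by
    refine Finset.sum_le_sum fun x _ => ?_
    rw [Fin.sum_univ_four]
    linarith [hTnn x 2, hTnn x 3]
  refine le_trans ?_ hdrop
  -- slice the box: `x = (x₀, x₁, u, v)`, `(u, v)` outermost
  rw [sum_finTorusSite_slices, sum_finTorusSite_slices (f := fun x => T x 0 + T x 1), Finset.mul_sum]
  refine Finset.sum_le_sum fun p _ => ?_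
  have hshift0 : ∀ (x₀ x₁ : Fin ℓ), FinTorusSite.shift ((x₀, x₁, p.1, p.2) : FinTorusSite ℓ ℓ L₂ L₃) 0 =
      (x₀ + 1, x₁, p.1, p.2) := fun x₀ x₁ => by
    simp [FinTorusSite.shift, finRotate_apply]
  have hshift1 : ∀ (x₀ x₁ : Fin ℓ), FinTorusSite.shift ((x₀, x₁, p.1, p.2) : FinTorusSite ℓ ℓ L₂ L₃) 1 =
      (x₀, x₁ + 1, p.1, p.2) := fun x₀ x₁ => by
    simp [FinTorusSite.shift, finRotate_apply]
  have hc0 : ∀ (x₀ x₁ : Fin ℓ), finTorusSiteCoord ((x₀, x₁, p.1, p.2) : FinTorusSite ℓ ℓ L₂ L₃) 0 = (x₀ : ℕ) :=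
    fun x₀ x₁ => by simp [finTorusSiteCoord]
  have hc1 : ∀ (x₀ x₁ : Fin ℓ), finTorusSiteCoord ((x₀, x₁, p.1, p.2) : FinTorusSite ℓ ℓ L₂ L₃) 1 = (x₁ : ℕ) :=
    fun x₀ x₁ => by simp [finTorusSiteCoord]
  have key := ladder_poincare_sharp hAu hBu hω hAB (Φ := fun x₀ x₁ => Φ (x₀, x₁, p.1, p.2))
    (fun x₀ x₁ => htr _) (U₀ := fun x₀ x₁ => U ((x₀, x₁, p.1, p.2), 0))
    (U₁ := fun x₀ x₁ => U ((x₀, x₁, p.1, p.2), 1))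
    (fun x₁ => hU0z _ (by rw [hc0, Fin.val_zero]))
    (fun x₀ x₁ hx => hU0 _ (by rw [hc0]; exact fun h => hx (Fin.ext (by rw [h, Fin.val_zero]))))
    (fun x₀ => hU1z _ (by rw [hc1, Fin.val_zero]))
    (fun x₀ x₁ hx => hU1 _ (by rw [hc1]; exact fun h => hx (Fin.ext (by rw [h, Fin.val_zero]))))
  simp only [hT, hshift0, hshift1]
  exact key

end Gap

end Literature.MathematicalPhysics.QuantumLattice
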